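import Summits.Parity.GeneralizedHardyLittlewood.Theorems.BeyondDiagonalBeatsQuarter.OffDiagLayersTail
import Summits.Parity.GeneralizedHardyLittlewood.Theorems.BeyondDiagonalBeatsQuarter.OffDiagCleanScales
import HarnessLib

/-!
# Route `PrimeLevelFamEdge`, crux K_B (stmt-Parity-20343), line `diagonal_kernel_split` rev 4, plan Ω,
# step Ω-d3 `OffDiagLayers` (part 3): the `r`-truncation AT THE LEVEL OF THE HEART — the MOLLIFIED
# off-diagonal is `2q̂(2π/q)·Σ_{r ≤ R}` (mollified layer `r`) plus an explicitly polynomial tail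

Parts 1–2 (`OffDiagLayers.lean`, `OffDiagLayersTail.lean`) reorganise `offDiag q l m` by Petersson modulus
`c = q·r` for one pair `(l, m)`. The rev-4 heart `stub_offDiagBelowSlack_io` (and `offDiagMollified`,
`OffDiagCleanScales.lean`) is about the MOLLIFIED sum `Σ_{l,m ≤ M} c_l c_m·offDiag q l m`, `c_m = mollifierCoeff P M m`
(`P = X²`, `M = q̂^{Δ′}` in the heart). Here, by finite-sum algebra over parts 1–2:
* §1 `Σ_{l,m ≤ M} c_l c_m·offDiag q l m = 2q̂(2π/q)·Σ_{1 ≤ r ≤ R} Σ_{l,m ≤ M} c_l c_m·offDiagLayer q l m r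
  + 2q̂(2π/q)·Σ_{l,m ≤ M} c_l c_m·Σ_{k ≥ 0} offDiagLayer q l m (k+R+1)` for every `R` (`mollified_offDiag_eq_head_add_tail`),
  and the same for `offDiagMollified Δ′ q` (real parts, `offDiagMollified_eq_head_add_tail`);
* §2 the tail is polynomially small in `R`, with every exponent explicit: for `|P| ≤ B_P` on `[0,1]` there is
  `K = K(B_P)` with `‖2q̂(2π/q)·Σ_{l,m ≤ M} c_l c_m·Σ_{k≥0} offDiagLayer q l m (k+R+1)‖ ≤ K·q̂⁴ q^{−3/2}·M^{13/5}·(R+1)^{−2/5}`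
  for all primes `q`, all `M > 1`, all `R` (`exists_norm_mollified_offDiagTail_le`; `|c_m| ≤ B_P m^{−1/2}`,
  `τ(m) ≤ C m^{1/20}`, `offDiagSize ≤ B·τ(l)τ(m)(lm)^{3/4}q̂³`, tail `≤ A q^{−1/2}(R+1)^{−2/5}·offDiagSize`);
  at `P = X²`: `exists_abs_offDiagMollified_tail_le`.
So along any sequence of levels the heart's left side equals `−re(2q̂(2π/q)·Σ_{r ≤ R(q)} mollified layer r)` up to
`O(q̂⁴q^{−3/2}M^{13/5}R(q)^{−2/5})`, which is `o(mainScaleReal)` as soon as `R(q)` is a large enough POWER of `q`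
(the choice is Ω-d5's). Identities and absolute-value bounds only; nothing about the heart is claimed.
Helper (`--supports stmt-Parity-20343`); standard axioms.
«The programme SEARCHES and TYPES; no claim about Landau–Siegel zeros, Theorems 1–2 of arXiv:2211.02515 or
a repaired Margin232 until a kernel theorem says so.»
-/

noncomputable section

open Finset Polynomial
open scoped Real

namespace Summit.Parity.GeneralizedHardyLittlewood.Theorems.BeyondDiagonalBeatsQuarter.PeterssonSplit

open Literature.NumberTheory.LFunctions Literature.NumberTheory.LFunctions.KMV2000
open Summit.Parity.GeneralizedHardyLittlewood.Theorems.PrimeLevelFamEdgeIdeaDeltas.PeterssonLayers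
  (norm_mollifierCoeff_le sum_Icc_rpow_le)

variable {q : ℕ} [NeZero q]

/-! ### §1. The mollified split (finite-sum algebra over `offDiag_eq_head_add_tail`) -/

/-- **The mollified off-diagonal, truncated in the Petersson modulus.** For `q` prime, any profile `P`, any
length `M` and any `R`:
`Σ_{l,m ≤ M} c_l c_m·offDiag q l m = 2q̂(2π/q)·Σ_{1≤r≤R} Σ_{l,m ≤ M} c_l c_m·offDiagLayer q l m r
 + 2q̂(2π/q)·Σ_{l,m ≤ M} c_l c_m·Σ_{k≥0} offDiagLayer q l m (k+R+1)`, `c_m = mollifierCoeff P M m`.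
[cite: KowalskiMichelVanderKam2000, (21)–(23) p. 12 and Lemma 3.3 p. 9; KowalskiMichel2000, §2.4.2 p. 312 — derivation] -/
theorem mollified_offDiag_eq_head_add_tail (hq : q.Prime) (P : ℝ[X]) (M : ℝ) (R : ℕ) :
    ∑ l ∈ Icc 1 ⌊M⌋₊, ∑ m ∈ Icc 1 ⌊M⌋₊,
        ((mollifierCoeff P M l * mollifierCoeff P M m : ℝ) : ℂ) * offDiag q l m =
      2 * (qhat q : ℂ) * (2 * π / q) *
          ∑ r ∈ Icc 1 R, ∑ l ∈ Icc 1 ⌊M⌋₊, ∑ m ∈ Icc 1 ⌊M⌋₊,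
            ((mollifierCoeff P M l * mollifierCoeff P M m : ℝ) : ℂ) * offDiagLayer q l m r +
        2 * (qhat q : ℂ) * (2 * π / q) *
          ∑ l ∈ Icc 1 ⌊M⌋₊, ∑ m ∈ Icc 1 ⌊M⌋₊,
            ((mollifierCoeff P M l * mollifierCoeff P M m : ℝ) : ℂ) *
              ∑' k : ℕ, offDiagLayer q l m (k + (R + 1)) := by
  set K : ℂ := 2 * (qhat q : ℂ) * (2 * π / q) with hK
  have hterm : ∀ l ∈ Icc 1 ⌊M⌋₊, ∀ m ∈ Icc 1 ⌊M⌋₊,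
      ((mollifierCoeff P M l * mollifierCoeff P M m : ℝ) : ℂ) * offDiag q l m =
        K * (((mollifierCoeff P M l * mollifierCoeff P M m : ℝ) : ℂ) *
            ∑ r ∈ Icc 1 R, offDiagLayer q l m r) +
          K * (((mollifierCoeff P M l * mollifierCoeff P M m : ℝ) : ℂ) *
            ∑' k : ℕ, offDiagLayer q l m (k + (R + 1))) := by
    intro l hl m hm
    rw [offDiag_eq_head_add_tail hq (Finset.mem_Icc.1 hl).1 (Finset.mem_Icc.1 hm).1 R, ← hK]
    ring
  have hhead : ∑ l ∈ Icc 1 ⌊M⌋₊, ∑ m ∈ Icc 1 ⌊M⌋₊,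
      ((mollifierCoeff P M l * mollifierCoeff P M m : ℝ) : ℂ) * ∑ r ∈ Icc 1 R, offDiagLayer q l m r =
      ∑ r ∈ Icc 1 R, ∑ l ∈ Icc 1 ⌊M⌋₊, ∑ m ∈ Icc 1 ⌊M⌋₊,
        ((mollifierCoeff P M l * mollifierCoeff P M m : ℝ) : ℂ) * offDiagLayer q l m r :=
    calc ∑ l ∈ Icc 1 ⌊M⌋₊, ∑ m ∈ Icc 1 ⌊M⌋₊,
          ((mollifierCoeff P M l * mollifierCoeff P M m : ℝ) : ℂ) * ∑ r ∈ Icc 1 R, offDiagLayer q l m r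
        = ∑ l ∈ Icc 1 ⌊M⌋₊, ∑ m ∈ Icc 1 ⌊M⌋₊, ∑ r ∈ Icc 1 R,
            ((mollifierCoeff P M l * mollifierCoeff P M m : ℝ) : ℂ) * offDiagLayer q l m r := by
          simp_rw [Finset.mul_sum]
      _ = ∑ l ∈ Icc 1 ⌊M⌋₊, ∑ r ∈ Icc 1 R, ∑ m ∈ Icc 1 ⌊M⌋₊,
            ((mollifierCoeff P M l * mollifierCoeff P M m : ℝ) : ℂ) * offDiagLayer q l m r :=
          Finset.sum_congr rfl fun l _ ↦ Finset.sum_comm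
      _ = _ := Finset.sum_comm
  rw [Finset.sum_congr rfl fun l hl ↦ Finset.sum_congr rfl fun m hm ↦ hterm l hl m hm]
  simp only [Finset.sum_add_distrib, ← Finset.mul_sum]
  rw [hhead]

/-- **The same at the level of the heart.** For `q` prime, `Δ′` and every `R`:
`offDiagMollified Δ′ q = −re(2q̂(2π/q)·Σ_{1≤r≤R} Σ_{l,m} c_l c_m·offDiagLayer q l m r)
 − re(2q̂(2π/q)·Σ_{l,m} c_l c_m·Σ_{k≥0} offDiagLayer q l m (k+R+1))`, `c_m = mollifierCoeff X² q̂^{Δ′} m`.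
[cite: KowalskiMichelVanderKam2000, (21)–(23) p. 12 and Lemma 3.3 p. 9; KowalskiMichel2000, §2.4.2 p. 312 — derivation] -/
theorem offDiagMollified_eq_head_add_tail (hq : q.Prime) (Δ' : ℝ) (R : ℕ) :
    offDiagMollified Δ' q =
      -(2 * (qhat q : ℂ) * (2 * π / q) *
          ∑ r ∈ Icc 1 R, ∑ l ∈ Icc 1 ⌊qhat q ^ Δ'⌋₊, ∑ m ∈ Icc 1 ⌊qhat q ^ Δ'⌋₊,
            ((mollifierCoeff (X ^ 2) (qhat q ^ Δ') l * mollifierCoeff (X ^ 2) (qhat q ^ Δ') m : ℝ) : ℂ) *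
              offDiagLayer q l m r).re -
        (2 * (qhat q : ℂ) * (2 * π / q) *
          ∑ l ∈ Icc 1 ⌊qhat q ^ Δ'⌋₊, ∑ m ∈ Icc 1 ⌊qhat q ^ Δ'⌋₊,
            ((mollifierCoeff (X ^ 2) (qhat q ^ Δ') l * mollifierCoeff (X ^ 2) (qhat q ^ Δ') m : ℝ) : ℂ) *
              ∑' k : ℕ, offDiagLayer q l m (k + (R + 1))).re := by
  rw [offDiagMollified_eq, mollified_offDiag_eq_head_add_tail hq (X ^ 2) (qhat q ^ Δ') R, Complex.add_re]
  ring

/-! ### §2. The mollified tail is polynomially small in `R` -/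

omit [NeZero q] in
/-- The norm of the Petersson prefactor: `‖2q̂·(2π/q)‖ = 4π q̂/q`. [cite: KowalskiMichel2000, §2.4.2 p. 312 — derivation] -/
theorem norm_prefactor (hq : 1 ≤ q) : ‖(2 * (qhat q : ℂ) * (2 * π / q))‖ = 4 * π * qhat q / q := by
  have hQ : 0 < qhat q := qhat_pos hq
  rw [norm_mul, norm_mul, norm_div, norm_mul, Complex.norm_ofNat, Complex.norm_real, Complex.norm_real,
    Complex.norm_natCast, Real.norm_of_nonneg hQ.le, Real.norm_of_nonneg Real.pi_pos.le]
  ring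

omit [NeZero q] in
/-- **One mollified pair against the polynomial size**: for `|P| ≤ B_P` on `[0,1]`, `M > 1`, `τ(r) ≤ C r^{1/20}`,
and `l, m ∈ [1, M]`: `|c_l c_m|·τ(l)τ(m)(lm)^{3/4} ≤ B_P² C² · l^{3/10} m^{3/10}`
(`|c_m| ≤ B_P m^{−1/2}`, `−1/2 + 1/20 + 3/4 = 3/10`). [cite: KowalskiMichelVanderKam2000, (9) p. 7 — derivation] -/
theorem norm_coeffPair_mul_size_le {P : ℝ[X]} {Bp : ℝ} (hB : ∀ t ∈ Set.Icc (0 : ℝ) 1, |P.eval t| ≤ Bp)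
    {M : ℝ} (hM : 1 < M) {C : ℝ} (hC : ∀ r : ℕ, ((r.divisors.card : ℕ) : ℝ) ≤ C * (r : ℝ) ^ (1 / 20 : ℝ))
    {l m : ℕ} (hl : l ∈ Icc 1 ⌊M⌋₊) (hm : m ∈ Icc 1 ⌊M⌋₊) :
    ‖((mollifierCoeff P M l * mollifierCoeff P M m : ℝ) : ℂ)‖ *
        (((l.divisors.card : ℝ) * (m.divisors.card : ℝ)) * ((l : ℝ) * m) ^ (3 / 4 : ℝ)) ≤
      Bp ^ 2 * C ^ 2 * ((l : ℝ) ^ (3 / 10 : ℝ) * (m : ℝ) ^ (3 / 10 : ℝ)) := by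
  have hl0 : (0 : ℝ) < l := by exact_mod_cast (Finset.mem_Icc.1 hl).1
  have hm0 : (0 : ℝ) < m := by exact_mod_cast (Finset.mem_Icc.1 hm).1
  have hBp : 0 ≤ Bp := (abs_nonneg _).trans (hB 0 ⟨le_rfl, zero_le_one⟩)
  have hC0 : 0 ≤ C := by
    have h := hC 1
    simp at h
    linarith
  have hcl := norm_mollifierCoeff_le hB hM hl
  have hcm := norm_mollifierCoeff_le hB hM hm
  have hτl := hC l
  have hτm := hC m
  have hsplit : ((l : ℝ) * m) ^ (3 / 4 : ℝ) = (l : ℝ) ^ (3 / 4 : ℝ) * (m : ℝ) ^ (3 / 4 : ℝ) :=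
    Real.mul_rpow hl0.le hm0.le
  have hpl : (l : ℝ) ^ (-(1 / 2 : ℝ)) * (l : ℝ) ^ (1 / 20 : ℝ) * (l : ℝ) ^ (3 / 4 : ℝ) = (l : ℝ) ^ (3 / 10 : ℝ) := by
    rw [← Real.rpow_add hl0, ← Real.rpow_add hl0]; norm_num
  have hpm : (m : ℝ) ^ (-(1 / 2 : ℝ)) * (m : ℝ) ^ (1 / 20 : ℝ) * (m : ℝ) ^ (3 / 4 : ℝ) = (m : ℝ) ^ (3 / 10 : ℝ) := by
    rw [← Real.rpow_add hm0, ← Real.rpow_add hm0]; norm_num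
  rw [Complex.ofReal_mul, norm_mul, hsplit]
  calc ‖(mollifierCoeff P M l : ℂ)‖ * ‖(mollifierCoeff P M m : ℂ)‖ *
        (((l.divisors.card : ℝ) * (m.divisors.card : ℝ)) * ((l : ℝ) ^ (3 / 4 : ℝ) * (m : ℝ) ^ (3 / 4 : ℝ)))
      ≤ (Bp * (l : ℝ) ^ (-(1 / 2 : ℝ))) * (Bp * (m : ℝ) ^ (-(1 / 2 : ℝ))) *
          ((C * (l : ℝ) ^ (1 / 20 : ℝ)) * (C * (m : ℝ) ^ (1 / 20 : ℝ)) *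
            ((l : ℝ) ^ (3 / 4 : ℝ) * (m : ℝ) ^ (3 / 4 : ℝ))) := by
        gcongr
    _ = Bp ^ 2 * C ^ 2 * (((l : ℝ) ^ (-(1 / 2 : ℝ)) * (l : ℝ) ^ (1 / 20 : ℝ) * (l : ℝ) ^ (3 / 4 : ℝ)) *
          ((m : ℝ) ^ (-(1 / 2 : ℝ)) * (m : ℝ) ^ (1 / 20 : ℝ) * (m : ℝ) ^ (3 / 4 : ℝ))) := by ring
    _ = _ := by rw [hpl, hpm]

/-- **Ω-d3, the mollified `r`-tail is polynomially small, with explicit exponents.** For a profile `P` with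
`|P| ≤ B_P` on `[0,1]` there is `K ≥ 0` (`= 4π·A·B·C²·B_P²` from `exists_norm_offDiagTail_le`,
`exists_offDiagSize_le`, the divisor bound at `1/20`) such that for all primes `q`, all `M > 1`, all `R`:
`‖2q̂(2π/q)·Σ_{l,m ≤ M} c_l c_m·Σ_{k≥0} offDiagLayer q l m (k+R+1)‖ ≤ K·q̂⁴·q^{−3/2}·M^{13/5}·(R+1)^{−2/5}`.
[cite: KowalskiMichel2000, §2.4.2 p. 312 (23); KowalskiMichelVanderKam2000, (9) p. 7, (22) p. 12 — derivation] -/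
theorem exists_norm_mollified_offDiagTail_le {P : ℝ[X]} {Bp : ℝ}
    (hB : ∀ t ∈ Set.Icc (0 : ℝ) 1, |P.eval t| ≤ Bp) :
    ∃ K : ℝ, 0 ≤ K ∧ ∀ (q : ℕ) [NeZero q], q.Prime → ∀ M : ℝ, 1 < M → ∀ R : ℕ,
      ‖2 * (qhat q : ℂ) * (2 * π / q) *
          ∑ l ∈ Icc 1 ⌊M⌋₊, ∑ m ∈ Icc 1 ⌊M⌋₊,
            ((mollifierCoeff P M l * mollifierCoeff P M m : ℝ) : ℂ) *
              ∑' k : ℕ, offDiagLayer q l m (k + (R + 1))‖ ≤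
        K * qhat q ^ 4 * (q : ℝ) ^ (-(3 / 2 : ℝ)) * M ^ (13 / 5 : ℝ) * (((R + 1 : ℕ) : ℝ)) ^ (-(2 / 5 : ℝ)) := by
  obtain ⟨A, hA0, hA⟩ := exists_norm_offDiagTail_le
  obtain ⟨B, hB0, hBsz⟩ := exists_offDiagSize_le
  obtain ⟨C, hC1, hC⟩ :=
    Literature.NumberTheory.Sieve.exists_card_divisors_le_mul_rpow' (by norm_num : (0 : ℝ) < 1 / 20)
  have hC0 : 0 ≤ C := zero_le_one.trans hC1
  have hBp : 0 ≤ Bp := (abs_nonneg _).trans (hB 0 ⟨le_rfl, zero_le_one⟩)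
  refine ⟨4 * π * A * B * C ^ 2 * Bp ^ 2, by positivity, fun q _ hq M hM R ↦ ?_⟩
  have hq1 : 1 ≤ q := hq.one_lt.le
  have hq0 : (0 : ℝ) < q := by exact_mod_cast hq.pos
  have hQ : 0 < qhat q := qhat_pos hq1
  have hM0 : 0 < M := by linarith
  -- the per-pair weight of the tail
  set W : ℝ := A * (q : ℝ) ^ (-(1 / 2 : ℝ)) * (((R + 1 : ℕ) : ℝ)) ^ (-(2 / 5 : ℝ)) * (B * qhat q ^ 3) with hW
  have hW0 : 0 ≤ W := by positivity
  have hpair : ∀ l ∈ Icc 1 ⌊M⌋₊, ∀ m ∈ Icc 1 ⌊M⌋₊,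
      ‖((mollifierCoeff P M l * mollifierCoeff P M m : ℝ) : ℂ) * ∑' k : ℕ, offDiagLayer q l m (k + (R + 1))‖ ≤
        W * (Bp ^ 2 * C ^ 2) * ((l : ℝ) ^ (3 / 10 : ℝ) * (m : ℝ) ^ (3 / 10 : ℝ)) := by
    intro l hl m hm
    have hl1 := (Finset.mem_Icc.1 hl).1
    have hm1 := (Finset.mem_Icc.1 hm).1
    have htail := hA q hq l m R hl1 hm1
    have hsize := hBsz q hq1 l m hl1 hm1
    have hc0 := norm_nonneg (((mollifierCoeff P M l * mollifierCoeff P M m : ℝ) : ℂ))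
    rw [norm_mul]
    calc ‖((mollifierCoeff P M l * mollifierCoeff P M m : ℝ) : ℂ)‖ *
          ‖∑' k : ℕ, offDiagLayer q l m (k + (R + 1))‖
        ≤ ‖((mollifierCoeff P M l * mollifierCoeff P M m : ℝ) : ℂ)‖ *
            (A * (q : ℝ) ^ (-(1 / 2 : ℝ)) * (((R + 1 : ℕ) : ℝ)) ^ (-(2 / 5 : ℝ)) *
              (B * ((l.divisors.card : ℝ) * (m.divisors.card : ℝ)) * ((l : ℝ) * m) ^ (3 / 4 : ℝ) *
                qhat q ^ 3)) := by
          refine mul_le_mul_of_nonneg_left (htail.trans ?_) hc0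
          exact mul_le_mul_of_nonneg_left hsize (by positivity)
      _ = W * (‖((mollifierCoeff P M l * mollifierCoeff P M m : ℝ) : ℂ)‖ *
            (((l.divisors.card : ℝ) * (m.divisors.card : ℝ)) * ((l : ℝ) * m) ^ (3 / 4 : ℝ))) := by
          rw [hW]; ring
      _ ≤ W * (Bp ^ 2 * C ^ 2 * ((l : ℝ) ^ (3 / 10 : ℝ) * (m : ℝ) ^ (3 / 10 : ℝ))) :=
          mul_le_mul_of_nonneg_left (norm_coeffPair_mul_size_le hB hM hC hl hm) hW0
      _ = _ := by ring
  -- sum over the pairs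
  have hS : ∑ l ∈ Icc 1 ⌊M⌋₊, ((l : ℝ)) ^ (3 / 10 : ℝ) ≤ M ^ (13 / 10 : ℝ) := by
    have := sum_Icc_rpow_le hM.le (by norm_num : (0 : ℝ) ≤ 3 / 10)
    norm_num at this ⊢
    exact this
  have hS0 : 0 ≤ ∑ l ∈ Icc 1 ⌊M⌋₊, ((l : ℝ)) ^ (3 / 10 : ℝ) := Finset.sum_nonneg fun _ _ ↦ by positivity
  have hsum : ‖∑ l ∈ Icc 1 ⌊M⌋₊, ∑ m ∈ Icc 1 ⌊M⌋₊,
      ((mollifierCoeff P M l * mollifierCoeff P M m : ℝ) : ℂ) * ∑' k : ℕ, offDiagLayer q l m (k + (R + 1))‖ ≤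
      W * (Bp ^ 2 * C ^ 2) * M ^ (13 / 5 : ℝ) := by
    calc ‖∑ l ∈ Icc 1 ⌊M⌋₊, ∑ m ∈ Icc 1 ⌊M⌋₊, ((mollifierCoeff P M l * mollifierCoeff P M m : ℝ) : ℂ) *
          ∑' k : ℕ, offDiagLayer q l m (k + (R + 1))‖
        ≤ ∑ l ∈ Icc 1 ⌊M⌋₊, ∑ m ∈ Icc 1 ⌊M⌋₊,
            W * (Bp ^ 2 * C ^ 2) * ((l : ℝ) ^ (3 / 10 : ℝ) * (m : ℝ) ^ (3 / 10 : ℝ)) :=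
          (norm_sum_le _ _).trans (Finset.sum_le_sum fun l hl ↦
            (norm_sum_le _ _).trans (Finset.sum_le_sum fun m hm ↦ hpair l hl m hm))
      _ = W * (Bp ^ 2 * C ^ 2) * ((∑ l ∈ Icc 1 ⌊M⌋₊, ((l : ℝ)) ^ (3 / 10 : ℝ)) *
            (∑ m ∈ Icc 1 ⌊M⌋₊, ((m : ℝ)) ^ (3 / 10 : ℝ))) := by
          rw [Finset.sum_mul_sum, Finset.mul_sum]
          refine Finset.sum_congr rfl fun l _ ↦ ?_
          rw [Finset.mul_sum]
      _ ≤ W * (Bp ^ 2 * C ^ 2) * (M ^ (13 / 10 : ℝ) * M ^ (13 / 10 : ℝ)) := by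
          refine mul_le_mul_of_nonneg_left (mul_le_mul hS hS hS0 (by positivity)) (by positivity)
      _ = W * (Bp ^ 2 * C ^ 2) * M ^ (13 / 5 : ℝ) := by
          rw [← Real.rpow_add hM0]; norm_num
  -- assemble with the prefactor
  have hq32 : qhat q / q * (q : ℝ) ^ (-(1 / 2 : ℝ)) = qhat q * (q : ℝ) ^ (-(3 / 2 : ℝ)) := by
    rw [div_eq_mul_inv, ← Real.rpow_neg_one, mul_assoc, ← Real.rpow_add hq0]
    norm_num
  rw [norm_mul, norm_prefactor hq1]
  calc 4 * π * qhat q / q * ‖∑ l ∈ Icc 1 ⌊M⌋₊, ∑ m ∈ Icc 1 ⌊M⌋₊,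
        ((mollifierCoeff P M l * mollifierCoeff P M m : ℝ) : ℂ) * ∑' k : ℕ, offDiagLayer q l m (k + (R + 1))‖
      ≤ 4 * π * qhat q / q * (W * (Bp ^ 2 * C ^ 2) * M ^ (13 / 5 : ℝ)) :=
        mul_le_mul_of_nonneg_left hsum (by positivity)
    _ = 4 * π * A * B * C ^ 2 * Bp ^ 2 * qhat q ^ 3 * (qhat q / q * (q : ℝ) ^ (-(1 / 2 : ℝ))) *
          M ^ (13 / 5 : ℝ) * (((R + 1 : ℕ) : ℝ)) ^ (-(2 / 5 : ℝ)) := by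
        rw [hW]; ring
    _ = _ := by rw [hq32]; ring

/-- `|t²| ≤ 1` on `[0,1]`: the `X²` profile has `B_P = 1`. [cite: KowalskiMichelVanderKam2000, (9) p. 7] -/
theorem abs_eval_X_sq_le_one : ∀ t ∈ Set.Icc (0 : ℝ) 1, |(X ^ 2 : ℝ[X]).eval t| ≤ 1 := by
  intro t ht
  rw [eval_pow, eval_X, abs_pow, abs_of_nonneg ht.1]
  exact pow_le_one₀ ht.1 ht.2

/-- **At the heart's profile `P = X²`**: there is an absolute `K ≥ 0` such that for all primes `q`, all `Δ′`
with `q̂^{Δ′} > 1` and all `R`, the real tail in `offDiagMollified_eq_head_add_tail` is at most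
`K·q̂⁴·q^{−3/2}·(q̂^{Δ′})^{13/5}·(R+1)^{−2/5}` in absolute value.
[cite: KowalskiMichel2000, §2.4.2 p. 312 (23); KowalskiMichelVanderKam2000, (9) p. 7, (22) p. 12 — derivation] -/
theorem exists_abs_offDiagMollified_tail_le :
    ∃ K : ℝ, 0 ≤ K ∧ ∀ (q : ℕ) [NeZero q], q.Prime → ∀ Δ' : ℝ, 1 < qhat q ^ Δ' → ∀ R : ℕ,
      |(2 * (qhat q : ℂ) * (2 * π / q) *
          ∑ l ∈ Icc 1 ⌊qhat q ^ Δ'⌋₊, ∑ m ∈ Icc 1 ⌊qhat q ^ Δ'⌋₊,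
            ((mollifierCoeff (X ^ 2) (qhat q ^ Δ') l * mollifierCoeff (X ^ 2) (qhat q ^ Δ') m : ℝ) : ℂ) *
              ∑' k : ℕ, offDiagLayer q l m (k + (R + 1))).re| ≤
        K * qhat q ^ 4 * (q : ℝ) ^ (-(3 / 2 : ℝ)) * (qhat q ^ Δ') ^ (13 / 5 : ℝ) *
          (((R + 1 : ℕ) : ℝ)) ^ (-(2 / 5 : ℝ)) := by
  obtain ⟨K, hK0, hK⟩ := exists_norm_mollified_offDiagTail_le abs_eval_X_sq_le_one
  exact ⟨K, hK0, fun q _ hq Δ' hM R ↦ (Complex.abs_re_le_norm _).trans (hK q hq (qhat q ^ Δ') hM R)⟩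

end Summit.Parity.GeneralizedHardyLittlewood.Theorems.BeyondDiagonalBeatsQuarter.PeterssonSplit
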